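import Literature.Geometry.Lorentzian.KerrRedShiftBulkOffHorizon
import Literature.Geometry.Lorentzian.KerrRedShiftTimelike
import HarnessLib

/-!
# The horizon frame `{K, k, ∂̸}` of the Kerr–Schild chart is uniformly non-degenerate on a collar of
# the horizon, up to extremality: `∑_μ p_μ² ≤ 190(λ² + v² + |q̸|²)`
(namespace `Literature.Geometry.Lorentzian.Kerr`.)

First half of the `κ`-explicit red-shift coercivity (`KerrRedShiftCoercivityPoly.lean`). The exact bulk
term of the red-shift multiplier (`KerrRedShiftBulkOffHorizon.lean`) is coercive in the horizon-frame
density `λ² + v² + |q̸|²` (`λ = p(K)`, `v = p(k)`, `q̸` the angular part of `p + v dr`); the energy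
estimates are written in the Euclidean density `∑_μ p_μ²` of the Kerr–Schild chart. In the tree the
comparison of the two is qualitative (`Kerr.bulkForm_redShiftVector_pos_of_radius_eq_rPlus`: on `𝓗⁺`,
`λ = v = 0`, `q̸ = 0` forces `p = 0` because `ℓ(K) = 1/(2H) ≠ 0`). Here it is made quantitative and uniform
in `a`:

* `Kerr.frame_inversion_algebra` — the real-algebra core: `u = p(m)` is recovered from
  `g⁻¹(p, dr) = ((r² + a²)/Σ)λ − αp(Φ) − (Δ/Σ)v` (`Kerr.raisedDotRadius_eq_hawkingComp`) and
  `u = 2g⁻¹(p, dr) + (1 − 2H)v − 2p̸·∇̸r`, then `p₀`, `ℓ⃗·p⃗` from `(u, v)`, `|p̸|²` from `|q̸|²`; the axial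
  term `αp(Φ)` is absorbed because `|α| ≤ 2s/Σ` is small on the collar (`s = r − r₊`);
* `Kerr.collar_parameters` — the arithmetic of the linear collar `r₊ ≤ r ≤ r₊ + M²κ/4096`
  (`κ = Kerr.surfaceGravity M a`, `r₊ − M = 2Mr₊κ ≥ 2M²κ`, `r₊² + a² = 2Mr₊`);
* `Kerr.sum_sq_le_of_horizonFrame` — **for `|a| < M` and `r₊ ≤ r(x) ≤ r₊ + M²κ/4096`, every covector `p`
  has `∑_μ p_μ² ≤ 190(λ² + v² + |q̸|²)`.**

## References
* M. Dafermos, I. Rodnianski, arXiv:0811.0354, §3.3.2, Thm. 7.1 (key `DafermosRodnianski2008`).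
* M. Dafermos, I. Rodnianski, Y. Shlapentokh-Rothman, arXiv:1402.7034, Prop. 4.5.1
  (key `DafermosRodnianskiShlapentokhrothman2014`).
-/

noncomputable section

open Set Filter
open scoped Topology

namespace Literature.Geometry.Lorentzian.Kerr

variable {M a : ℝ} {x : E4}

/-! ### Real-algebra core -/

/-- `(cz)² ≤ B²z²` for `|c| ≤ B`. [folklore] -/
theorem sq_mul_le_of_abs_le {c B z : ℝ} (hc0 : -B ≤ c) (hc1 : c ≤ B) :
    (c * z) ^ 2 ≤ B ^ 2 * z ^ 2 := by
  rw [mul_pow]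
  refine mul_le_mul_of_nonneg_right ?_ (sq_nonneg z)
  nlinarith
/-- `p₀² + (ℓ⃗·p⃗)² ≤ u² + (9/2)v²` for `p₀ = ½u + ½(1 − 2H)v`, `ℓ⃗·p⃗ = ½u − ½(1 + 2H)v`, `0 ≤ H ≤ 1`.
[folklore] -/
theorem half_sq_add_half_sq_le {u v H : ℝ} (hH0 : 0 ≤ H) (hH1 : H ≤ 1) :
    (2⁻¹ * u + (1 - 2 * H) / 2 * v) ^ 2 + (2⁻¹ * u - (1 + 2 * H) / 2 * v) ^ 2 ≤
      u ^ 2 + 9 / 2 * v ^ 2 := by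
  have e : (2⁻¹ * u + (1 - 2 * H) / 2 * v) ^ 2 + (2⁻¹ * u - (1 + 2 * H) / 2 * v) ^ 2 =
      2⁻¹ * u ^ 2 - 2 * H * u * v + 2⁻¹ * (1 + 4 * H ^ 2) * v ^ 2 := by ring
  rw [e]
  have h1 : -(2 * H * u * v) ≤ 2⁻¹ * u ^ 2 + 2 * H ^ 2 * v ^ 2 := by
    nlinarith [sq_nonneg (u + 2 * H * v)]
  have h2 : H ^ 2 ≤ 1 := by nlinarith
  nlinarith [sq_nonneg v]
/-- **Frame inversion, real-algebra core.** In the notation of `KerrNullFrame.lean`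
(`u = p(m)`, `v = p(k)`, `p₀ = ½u + ½(1 − 2H)v`, `ℓ⃗·p⃗ = ½u − ½(1 + 2H)v`, `X = ∑_μ p_μ² = p₀² + (ℓ⃗·p⃗)² + |p̸|²`,
`Q = |q̸|² = |p̸|² + 2v(p̸·∇̸r) + v²|∇̸r|²`, `(p̸·∇̸r)² ≤ |p̸|²|∇̸r|²`, `|∇̸r|² ≤ 1`) and with `u` eliminated by
`u = 2((r² + a²)/Σ·λ − αE − (Δ/Σ)v) + (1 − 2H)v − 2p̸·∇̸r` (`E = p(Φ)`, `E² ≤ (r² + a²)X`): if `0 ≤ H ≤ 1`,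
`(r² + a²)/Σ ≤ 2`, `Δ/Σ ≤ 1/5` and `40α²(r² + a²) ≤ 1` then `X ≤ 190(λ² + v² + Q)`. [folklore] -/
theorem frame_inversion_algebra {u v lam p0 lp Qp Q Ap W E TS DS α X H T : ℝ}
    (hp0 : p0 = 2⁻¹ * u + (1 - 2 * H) / 2 * v) (hlp : lp = 2⁻¹ * u - (1 + 2 * H) / 2 * v)
    (hX : X = p0 ^ 2 + lp ^ 2 + Qp) (hQ : Q = Qp + 2 * v * Ap + v ^ 2 * W)
    (hCS : Ap ^ 2 ≤ Qp * W) (hW0 : 0 ≤ W) (hW1 : W ≤ 1) (hQp : 0 ≤ Qp)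
    (hu : u = 2 * (TS * lam - α * E - DS * v) + (1 - 2 * H) * v - 2 * Ap)
    (hH0 : 0 ≤ H) (hH1 : H ≤ 1) (hTS0 : 0 ≤ TS) (hTS : TS ≤ 2) (hDS0 : 0 ≤ DS) (hDS : DS ≤ 5⁻¹)
    (hE : E ^ 2 ≤ T * X) (hα : 40 * α ^ 2 * T ≤ 1) (hQ0 : 0 ≤ Q) :
    X ≤ 190 * (lam ^ 2 + v ^ 2 + Q) := by
  -- `Qp ≤ 2Q + 4v²`
  have hAp : Ap ^ 2 ≤ Qp := hCS.trans (mul_le_of_le_one_right hQp hW1)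
  have h1 : -(2 * v * Ap) ≤ Qp / 2 + 2 * v ^ 2 := by
    nlinarith only [sq_nonneg (Ap + 2 * v), hAp]
  have hvW : 0 ≤ v ^ 2 * W := mul_nonneg (sq_nonneg v) hW0
  have hQp2 : Qp ≤ 2 * Q + 4 * v ^ 2 := by linarith only [hQ, h1, hvW]
  -- `u²`
  have hu2 : u ^ 2 ≤ 5 * ((2 * TS * lam) ^ 2 + (-(2 * α) * E) ^ 2 + (-(2 * DS) * v) ^ 2 +
      ((1 - 2 * H) * v) ^ 2 + (-2 * Ap) ^ 2) := by
    have h : ∀ a b c d e : ℝ, (a + b + c + d + e) ^ 2 ≤ 5 * (a ^ 2 + b ^ 2 + c ^ 2 + d ^ 2 + e ^ 2) :=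
      fun a b c d e ↦ by
        nlinarith only [sq_nonneg (a - b), sq_nonneg (a - c), sq_nonneg (a - d), sq_nonneg (a - e),
          sq_nonneg (b - c), sq_nonneg (b - d), sq_nonneg (b - e), sq_nonneg (c - d), sq_nonneg (c - e),
          sq_nonneg (d - e)]
    have e : 2 * TS * lam + -(2 * α) * E + -(2 * DS) * v + (1 - 2 * H) * v + -2 * Ap = u := by
      rw [hu]; ring
    have h5 := h (2 * TS * lam) (-(2 * α) * E) (-(2 * DS) * v) ((1 - 2 * H) * v) (-2 * Ap)
    rwa [e] at h5
  have hTS2 : (2 * TS * lam) ^ 2 ≤ 4 ^ 2 * lam ^ 2 :=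
    sq_mul_le_of_abs_le (by linarith) (by linarith)
  have hαE2 : (-(2 * α) * E) ^ 2 = 4 * (α ^ 2 * E ^ 2) := by ring
  have hDS2 : (-(2 * DS) * v) ^ 2 ≤ (2 / 5) ^ 2 * v ^ 2 :=
    sq_mul_le_of_abs_le (by linarith) (by linarith)
  have hH2 : ((1 - 2 * H) * v) ^ 2 ≤ 1 ^ 2 * v ^ 2 :=
    sq_mul_le_of_abs_le (by linarith) (by linarith)
  have hAp2 : (-2 * Ap) ^ 2 = 4 * Ap ^ 2 := by ring
  rw [hαE2, hAp2] at hu2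
  -- `p0² + lp² ≤ u² + 4.5 v²`
  have hpl : p0 ^ 2 + lp ^ 2 ≤ u ^ 2 + 9 / 2 * v ^ 2 := by
    rw [hp0, hlp]; exact half_sq_add_half_sq_le hH0 hH1
  -- the `E²` term is half of `X`
  have hαE : 20 * (α ^ 2 * E ^ 2) ≤ X / 2 := by
    have h0 : 0 ≤ α ^ 2 := sq_nonneg α
    have h3 : α ^ 2 * E ^ 2 ≤ α ^ 2 * (T * X) := mul_le_mul_of_nonneg_left hE h0
    have hX0 : 0 ≤ X := by rw [hX]; positivity
    nlinarith only [h3, hα, hX0, sq_nonneg E, h0]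
  have hfin : X ≤ 160 * lam ^ 2 + 1886 / 10 * v ^ 2 + 84 * Q := by
    nlinarith only [hX, hpl, hu2, hTS2, hDS2, hH2, hAp, hαE, hQp2]
  nlinarith only [hfin, hQ0, sq_nonneg lam, sq_nonneg v]
/-! ### Geometry of the collar `r₊ ≤ r ≤ r₊ + M²κ/4096` -/

/-- **Parameters on the linear collar.** For `|a| < M` and `r₊ ≤ r ≤ r₊ + M²κ/4096` (`κ` the surface
gravity), with `s = r − r₊`, `δ = r₊ − M = 2Mr₊κ`: `0 < κ ≤ 1/(4M)`, `M ≤ r₊ ≤ 2M`, `0 ≤ s ≤ M²κ/4096`,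
`δ = 2Mr₊κ`, `2M²κ ≤ δ`, and `r₊² + a² = 2Mr₊`. [folklore] -/
theorem collar_parameters (hMa : IsSubextremal M a) {r : ℝ} (hr₁ : rPlus M a ≤ r)
    (hr₂ : r ≤ rPlus M a + M ^ 2 * surfaceGravity M a / 4096) :
    0 < surfaceGravity M a ∧ surfaceGravity M a ≤ 1 / (4 * M) ∧ M ≤ rPlus M a ∧ rPlus M a ≤ 2 * M ∧
      0 ≤ r - rPlus M a ∧ r - rPlus M a ≤ M ^ 2 * surfaceGravity M a / 4096 ∧
      rPlus M a - M = 2 * M * rPlus M a * surfaceGravity M a ∧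
      2 * M ^ 2 * surfaceGravity M a ≤ rPlus M a - M ∧ rPlus M a ^ 2 + a ^ 2 = 2 * M * rPlus M a := by
  have hM : 0 < M := hMa.pos
  have hMa' : |a| ≤ M := le_of_lt hMa
  have hκ : 0 < surfaceGravity M a := hMa.surfaceGravity_pos
  have hκle : surfaceGravity M a ≤ 1 / (4 * M) := surfaceGravity_le hM a
  have hδ : rPlus M a - M = 2 * M * rPlus M a * surfaceGravity M a :=
    rPlus_sub_self_eq_surfaceGravity hMa' hM
  have hrp : M ≤ rPlus M a := by
    linarith [rPlus_sub_self M a, Real.sqrt_nonneg (M ^ 2 - a ^ 2)]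
  have hrp2 : rPlus M a ≤ 2 * M := rPlus_le_two_mul_self hM.le a
  refine ⟨hκ, hκle, hrp, hrp2, by linarith, by linarith, hδ, ?_, rPlus_sq_add_sq hMa'⟩
  rw [hδ]
  nlinarith [mul_le_mul_of_nonneg_left hrp (by positivity : (0 : ℝ) ≤ 2 * M * surfaceGravity M a)]
/-- `(x₁p₂ − x₂p₁)² ≤ (x₁² + x₂²)(p₁² + p₂²)` (Lagrange's identity). [folklore] -/
theorem axialComp_sq_le (x₁ x₂ p₁ p₂ : ℝ) :
    (x₁ * p₂ - x₂ * p₁) ^ 2 ≤ (x₁ ^ 2 + x₂ ^ 2) * (p₁ ^ 2 + p₂ ^ 2) := by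
  nlinarith [sq_nonneg (x₁ * p₁ + x₂ * p₂)]
/-- The axial coefficient of `dr♯`: `ω₊(r² + a²)/Σ − a/Σ = a(r − r₊)(r + r₊)/(2Mr₊Σ)` (`ω₊ = a/(2Mr₊)`,
`r₊² + a² = 2Mr₊`). [folklore] -/
theorem axialCoeff_eq {a M rp r S : ℝ} (hra : rp ^ 2 + a ^ 2 = 2 * M * rp) (hS : S ≠ 0) (hM : M ≠ 0)
    (hrp : rp ≠ 0) :
    a / (2 * M * rp) * (r ^ 2 + a ^ 2) / S - a / S = a * ((r - rp) * (r + rp)) / (2 * M * rp * S) := by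
  rw [div_mul_eq_mul_div, div_div, div_sub_div _ _ (by positivity : 2 * M * rp * S ≠ 0) hS,
    div_eq_div_iff (by positivity) (by positivity)]
  linear_combination (2 * a * M * rp * S ^ 2) * hra
/-- `|a s(2r₊ + s)/(2Mr₊Σ)| ≤ 2s/Σ` for `|a| ≤ M`, `0 ≤ s ≤ 2r₊`. [folklore] -/
theorem abs_axialCoeff_le {a M rp s S : ℝ} (hS : 0 < S) (hM : 0 < M) (hrp : 0 < rp) (haM : |a| ≤ M)
    (hs0 : 0 ≤ s) (hsr : s ≤ 2 * rp) :
    |a * ((rp + s - rp) * (rp + s + rp)) / (2 * M * rp * S)| ≤ 2 * s / S := by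
  have hden : 0 < 2 * M * rp * S := by positivity
  rw [add_sub_cancel_left, abs_div, abs_of_pos hden, div_le_div_iff₀ hden hS, abs_mul, abs_mul,
    abs_of_nonneg hs0, abs_of_pos (by linarith : 0 < rp + s + rp)]
  have h1 : |a| * (rp + s + rp) ≤ M * (4 * rp) := mul_le_mul haM (by linarith) (by positivity) hM.le
  have h2 := mul_le_mul_of_nonneg_left h1 (mul_nonneg hs0 hS.le)
  nlinarith only [h2]
/-- `40α²T ≤ 1` from `|α| ≤ 2s/S`, `T ≤ 2S`, `s ≤ M/16384`, `M² ≤ S`. [folklore] -/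
theorem forty_mul_sq_mul_le {α s S T M : ℝ} (hS : 0 < S) (hαabs : |α| ≤ 2 * s / S)
    (hT2 : T ≤ 2 * S) (hT0 : 0 ≤ T) (hs0 : 0 ≤ s) (hs : s ≤ M / 16384) (hSM : M ^ 2 ≤ S) :
    40 * α ^ 2 * T ≤ 1 := by
  have h1 : α ^ 2 ≤ (2 * s / S) ^ 2 := by
    rw [← sq_abs]; exact pow_le_pow_left₀ (abs_nonneg _) hαabs 2
  have h2 : (2 * s / S) ^ 2 * T ≤ 8 * s ^ 2 / S := by
    rw [div_pow, div_mul_eq_mul_div, div_le_div_iff₀ (by positivity) hS]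
    have := mul_le_mul_of_nonneg_left hT2 (sq_nonneg (2 * s))
    nlinarith only [this, hS]
  have h3 : 8 * s ^ 2 / S ≤ 1 / 40 := by
    rw [div_le_div_iff₀ hS (by norm_num)]
    have h4 : s ^ 2 ≤ (M / 16384) ^ 2 := pow_le_pow_left₀ hs0 hs 2
    nlinarith only [h4, hSM]
  have h5 : α ^ 2 * T ≤ (2 * s / S) ^ 2 * T := mul_le_mul_of_nonneg_right h1 hT0
  nlinarith only [h5, h2, h3]
/-- `s(s + 2δ)/S ≤ 1/5` from `s ≤ M/16384`, `δ ≤ M`, `M² ≤ S`. [folklore] -/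
theorem mul_add_div_le_fifth {s δ M S : ℝ} (hS : 0 < S) (hs0 : 0 ≤ s) (hs : s ≤ M / 16384)
    (hδ0 : 0 ≤ δ) (hδ : δ ≤ M) (hSM : M ^ 2 ≤ S) : s * (s + 2 * δ) / S ≤ 5⁻¹ := by
  rw [div_le_iff₀ hS]
  have h1 : s + 2 * δ ≤ 3 * M := by linarith
  have h2 : s * (s + 2 * δ) ≤ M / 16384 * (3 * M) := mul_le_mul hs h1 (by positivity) (hs0.trans hs)
  nlinarith only [h2, hSM]
/-! ### The frame inversion on the collar -/

/-- **Frame inversion on the collar**: for `|a| < M` and a point `x` with `r₊ ≤ r(x) ≤ r₊ + M²κ/4096`,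
every covector `p` satisfies `∑_μ p_μ² ≤ 190(λ² + v² + |q̸|²)`, `λ = p(K)`, `v = p(k)`, `q̸ = (p + v dr)̸`
— the horizon frame `{K, k, ∂̸}` is uniformly non-degenerate in the Euclidean structure of the Kerr–Schild
chart up to extremality (`u` recovered from `g⁻¹(p, dr) = ((r² + a²)/Σ)λ − αp(Φ) − (Δ/Σ)v`,
`Kerr.raisedDotRadius_eq_hawkingComp`, with `|α| ≤ 2s/Σ`, `Δ = s(s + 2(r₊ − M))`, `s = r − r₊`).
[cite: DafermosRodnianski2008, Thm. 7.1] -/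
theorem sum_sq_le_of_horizonFrame (hMa : IsSubextremal M a) (hr₁ : rPlus M a ≤ radius a x)
    (hr₂ : radius a x ≤ rPlus M a + M ^ 2 * surfaceGravity M a / 4096) (p : Fin 4 → ℝ) :
    ∑ μ, p μ ^ 2 ≤ 190 * (hawkingComp M a x p ^ 2 + frameIn a x p ^ 2 +
      frameAngSq a x (p + frameIn a x p • dRadius a x)) := by
  have hM : 0 < M := hMa.pos
  have hMa' : |a| ≤ M := le_of_lt hMa
  obtain ⟨hκ, hκle, hrp, hrp2, hs0, hs1, hδ, hδlo, hra⟩ := collar_parameters hMa hr₁ hr₂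
  have hrp0 : 0 < rPlus M a := by linarith only [hM, hrp]
  obtain ⟨s, hs⟩ : ∃ s : ℝ, radius a x - rPlus M a = s := ⟨_, rfl⟩
  rw [hs] at hs0 hs1
  have hr : radius a x = rPlus M a + s := by linarith only [hs]
  have hx : 0 < radius a x := by linarith only [hr, hrp0, hs0]
  have hS := blSigma_spatial_pos hx
  set S := blSigma a (E4.spatial x) with hS_def
  have hRS : radius a x ^ 2 ≤ S := sq_le_blSigma_spatial hx
  have hSM : M ^ 2 ≤ S := by nlinarith only [hRS, hrp, hr, hs0, hM]
  have ha2 : a ^ 2 ≤ M ^ 2 := by nlinarith only [sq_abs a, abs_nonneg a, hMa']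
  have hMκ : M * surfaceGravity M a ≤ 1 / 4 := by
    rw [le_div_iff₀ (by positivity : (0 : ℝ) < 4 * M)] at hκle; linarith only [hκle]
  have hsM : s ≤ M / 16384 := by
    have : M ^ 2 * surfaceGravity M a / 4096 ≤ M / 16384 := by
      rw [div_le_div_iff₀ (by norm_num) (by norm_num)]; nlinarith only [hMκ, hM]
    linarith only [hs1, this]
  -- `W = |∇̸r|² = (r² + a² − Σ)/Σ ∈ [0, 1]`
  have hW0 : 0 ≤ frameAngSq a x (dRadius a x) := frameAngSq_nonneg hx _
  have hWeq : frameAngSq a x (dRadius a x) = (radius a x ^ 2 + a ^ 2 - S) / S := frameAngSq_dRadius hx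
  have hTS : S ≤ radius a x ^ 2 + a ^ 2 := by
    have h := hW0; rw [hWeq, le_div_iff₀ hS] at h; linarith only [h]
  have hT2 : radius a x ^ 2 + a ^ 2 ≤ 2 * S := by linarith only [hRS, ha2, hSM]
  have hW1 : frameAngSq a x (dRadius a x) ≤ 1 := by
    rw [hWeq, div_le_one hS]; linarith only [hT2]
  -- `H = Mr/Σ ∈ [0, 1]`
  have hHeq : scalarH M a x = M * radius a x / S := scalarH_eq_div_blSigma M a hx
  have hH0 : 0 ≤ scalarH M a x := by rw [hHeq]; positivity
  have hH1 : scalarH M a x ≤ 1 := by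
    rw [hHeq, div_le_one hS]
    have hMr : M ≤ radius a x := by linarith only [hrp, hr, hs0]
    nlinarith only [hRS, hMr, hM]
  -- `Δ = s(s + 2δ)`, `0 ≤ Δ/Σ ≤ 1/5`
  have hΔeq : radius a x ^ 2 - 2 * M * radius a x + a ^ 2 = s * (s + 2 * (rPlus M a - M)) := by
    rw [hr]; linear_combination hra
  have hΔ0 : 0 ≤ (radius a x ^ 2 - 2 * M * radius a x + a ^ 2) / S := by
    rw [hΔeq]; exact div_nonneg (by nlinarith only [hs0, hrp]) hS.le
  have hΔS : (radius a x ^ 2 - 2 * M * radius a x + a ^ 2) / S ≤ 5⁻¹ := by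
    rw [hΔeq]
    exact mul_add_div_le_fifth hS hs0 hsM (by linarith only [hrp]) (by linarith only [hrp2]) hSM
  -- the axial coefficient `α`, `|α| ≤ 2s/Σ`, `40α²(r² + a²) ≤ 1`
  have hαeq : horizonAngularVelocity M a * (radius a x ^ 2 + a ^ 2) / S - a / S =
      a * ((rPlus M a + s - rPlus M a) * (rPlus M a + s + rPlus M a)) / (2 * M * rPlus M a * S) := by
    rw [show horizonAngularVelocity M a = a / (2 * M * rPlus M a) from rfl,
      axialCoeff_eq hra hS.ne' hM.ne' hrp0.ne', hr]
  have hαabs : |horizonAngularVelocity M a * (radius a x ^ 2 + a ^ 2) / S - a / S| ≤ 2 * s / S := by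
    rw [hαeq]
    exact abs_axialCoeff_le hS hM hrp0 hMa' hs0 (by linarith only [hsM, hrp, hM])
  have hα : 40 * (horizonAngularVelocity M a * (radius a x ^ 2 + a ^ 2) / S - a / S) ^ 2 *
      (radius a x ^ 2 + a ^ 2) ≤ 1 :=
    forty_mul_sq_mul_le hS hαabs hT2 (by positivity) hs0 hsM hSM
  -- the identities of the frame
  have hu : frameOut M a x p = 2 * ((radius a x ^ 2 + a ^ 2) / S * hawkingComp M a x p -
      (horizonAngularVelocity M a * (radius a x ^ 2 + a ^ 2) / S - a / S) * (x 1 * p 2 - x 2 * p 1) -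
      (radius a x ^ 2 - 2 * M * radius a x + a ^ 2) / S * frameIn a x p) +
      (1 - 2 * scalarH M a x) * frameIn a x p - 2 * frameAng a x p (dRadius a x) := by
    rw [frameOut_eq_raisedDotRadius M a hx p, raisedDotRadius_eq_hawkingComp M a hx p]
  have hXeq : ∑ μ, p μ ^ 2 = p 0 ^ 2 + spatialDotNull a x p ^ 2 + frameAngSq a x p := by
    simp only [frameAngSq, Fin.sum_univ_four, Fin.sum_univ_three, Fin.isValue, Fin.succ_zero_eq_one,
      Fin.succ_one_eq_two]
    have : (2 : Fin 3).succ = (3 : Fin 4) := rfl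
    rw [this]
    ring
  have hQeq : frameAngSq a x (p + frameIn a x p • dRadius a x) = frameAngSq a x p +
      2 * frameIn a x p * frameAng a x p (dRadius a x) +
      frameIn a x p ^ 2 * frameAngSq a x (dRadius a x) :=
    frameAngSq_add_smul a x p (dRadius a x) (frameIn a x p)
  have hE : (x 1 * p 2 - x 2 * p 1) ^ 2 ≤ (radius a x ^ 2 + a ^ 2) * ∑ μ, p μ ^ 2 := by
    have h1 := axialComp_sq_le (x 1) (x 2) (p 1) (p 2)
    have h2 : x 1 ^ 2 + x 2 ^ 2 ≤ radius a x ^ 2 + a ^ 2 := sq_add_sq_le_radius_sq_add hx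
    have h3 : p 1 ^ 2 + p 2 ^ 2 ≤ ∑ μ, p μ ^ 2 := by
      simp only [Fin.sum_univ_four]; nlinarith only [sq_nonneg (p 0), sq_nonneg (p 3)]
    calc (x 1 * p 2 - x 2 * p 1) ^ 2 ≤ (x 1 ^ 2 + x 2 ^ 2) * (p 1 ^ 2 + p 2 ^ 2) := h1
      _ ≤ (radius a x ^ 2 + a ^ 2) * ∑ μ, p μ ^ 2 := mul_le_mul h2 h3 (by positivity) (by positivity)
  exact frame_inversion_algebra (apply_zero_eq_frame M a x p) (spatialDotNull_eq_frame M a x p) hXeq hQeq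
    (frameAng_sq_le hx p (dRadius a x)) hW0 hW1 (frameAngSq_nonneg hx p) hu hH0 hH1
    (by positivity) (by rw [div_le_iff₀ hS]; linarith only [hT2]) hΔ0 hΔS hE hα (frameAngSq_nonneg hx _)

end Literature.Geometry.Lorentzian.Kerr

end
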